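import Literature.NumberTheory.Automorphic.ArchPlaceCasimirScalar
import HarnessLib

/-!
# The higher Gelfand–Casimir operators of a place act by scalars on the Gårding space of an irreducible unitary representation

Topic `NumberTheory/Automorphic`; namespace `Literature.NumberTheory.Automorphic`. Definitions with
bodies and theorems (no named fact). Companion of `ArchPlaceCasimirReal`, `ArchPlaceCasimirComplex`,
`ArchPlaceCasimirScalar` (degree `2`). For a strongly continuous representation `τ` of
`G_∞ = GL_n(K_∞)` on a Hilbert space with Gårding space `𝒢`, a family of "letters"
`F_{ij} : 𝒢 → 𝒢` (`i, j ≤ n`) and `k ≥ 0`, the **closed-walk operator of length `k + 1`**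

  `T_{k+1} v = Σ_{i₀, …, i_k} F_{i₀ i₁} F_{i₁ i₂} ⋯ F_{i_k i₀} v`

(`placeCasimirDeg F k = Σ_i walkOp F k i i`, `walkOp F k i j = Σ` over walks of length `k + 1` from
`i` to `j`) is the image of the Gelfand–Casimir element `Σ E_{i₀i₁} E_{i₁i₂} ⋯ E_{i_k i₀}` of degree
`k + 1` of `U(𝔤𝔩_n)` — these generate the centre `𝔷(𝔤𝔩_n(ℂ))` (Gelfand (1950); Želobenko (1973),
§65; Knapp (1986), Ch. VIII §3 for degree `2`). We prove, for the letters of a REAL place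
(`F_{ij} = τ(E_{ij} ⊗ r_w)`) and for the holomorphic / antiholomorphic letters of a COMPLEX place
(`τ^{hol}(E_{ij})`, `τ^{anti}(E_{ij})`):

* `apply_walkOp_of_transform`, `apply_placeCasimirDeg_of_transform` — **abstract `Ad(G)`-invariance**:
  if `T F_{ij} u = Σ_{k,l} a_{ki} b_{jl} F_{kl} (T u)` on `𝒢` with `Σ_i a_{ki} b_{il} = δ_{kl}`, then the
  walk operators transform the same way and the closed-walk operator commutes with `T` (the inner
  contractions `Σ_l b_{l l″} a_{k″ l} = δ` telescope along the walk);
* `inner_walkOp_left`, `inner_placeCasimirDeg_left` — **formal adjoints**: if `⟪F_{ij} v, u⟫ =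
  -⟪v, F'_{ij} u⟫` for Gårding `v, u` (skew-symmetry of real directions; `hol ↔ anti` at a complex
  place), then `⟪T_{k+1} v, u⟫ = ⟪v, (-1)^{k+1} T'_{k+1} u⟫` with `T'` the closed-walk operator of the
  partner letters traversed backwards (`adjWalkOp`);
* `exists_placeCasimirRealDeg_eq_smul`, `exists_placeCasimirHolDeg_eq_smul`,
  `exists_placeCasimirAntiDeg_eq_smul` — **for an irreducible unitary `τ`, every `T_{k+1}` of a place is
  a scalar on `𝒢`**, by Segal's lemma (`ArchGardingSegal.exists_eq_smul_of_invariant_of_partner`) —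
  "`𝔷` operates by scalars on `ℋ^∞`" for ALL generators of the centre, as needed by the
  Casimir–Whittaker (Kostant) reduction of the last-row letters `E_{n,j}`, `j ≤ n - 2`, which uses the
  Gelfand–Casimir elements of degrees `3, …, n` (`Literature.Algebra.Lie.GL3Whittaker` for `n = 3`:
  hypotheses `T₂, T₃` scalar), on the route to Jacquet–Shalika's automatic continuity (Prop. (3.8))
  and the named fact `Literature.NumberTheory.Automorphic.JacquetShalika1981_archKirillovNorm_le` in
  ranks `≥ 3`.

## References

* I. M. Gelfand, *The center of an infinitesimal group ring*, Mat. Sb. 26 (1950), 103–112 (the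
  generators `Σ E_{i₀i₁} ⋯ E_{i_k i₀}` of `𝔷(𝔤𝔩_n)`) [folklore].
* A. W. Knapp, *Representation Theory of Semisimple Groups*, Princeton (1986), Ch. VIII §3
  (Casimir operator, `Ad(G)`-invariance, scalar in irreducible unitary representations) [Knapp1986].
* I. E. Segal, *Hypermaximality of certain operators on Lie groups*, Proc. AMS 3 (1952), 13–15
  [Segal1952].
* H. Jacquet, J. A. Shalika, *On Euler products and the classification of automorphic
  representations I*, Amer. J. Math. 103 (1981), §3, proof of Prop. (3.8), p. 523 ("`Z` operates by
  scalars") [JacquetShalikaAJM1981].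
* B. Kostant, *On Whittaker vectors and representation theory*, Invent. Math. 48 (1978), §2
  [Kostant1978Whittaker].
-/

noncomputable section

open MeasureTheory Measure NumberField NumberField.mixedEmbedding NumberField.InfinitePlace IsDedekindDomain Set Filter
open scoped MatrixGroups ENNReal NNReal Classical Topology InnerProductSpace ComplexConjugate

namespace Literature.NumberTheory.Automorphic

variable {n : ℕ} {K : Type} [Field K] [NumberField K]

attribute [local instance] glInfBorel borelSpace_glInf locallyCompactSpace_glInf secondCountableTopology_glInf

-- as in `ArchGardingWhittaker`
set_option backward.isDefEq.respectTransparency false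

/-! ### 1. Walk operators of a matrix of operators -/

section Abstract

variable {V : Type*} [AddCommGroup V] [Module ℂ V] {m : ℕ}

/-- **Walk operators**: `walkOp F k i j` is the sum over all walks `i = i₀ → i₁ → ⋯ → i_{k+1} = j` of
length `k + 1` of the composites `F_{i₀i₁} ∘ F_{i₁i₂} ∘ ⋯ ∘ F_{i_k i_{k+1}}` (peeled from the left:
`walkOp F (k+1) i j = Σ_l F_{il} ∘ walkOp F k l j`). [folklore] -/
def walkOp (F : Fin m → Fin m → V → V) : ℕ → Fin m → Fin m → V → V
  | 0, i, j, u => F i j u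
  | k + 1, i, j, u => ∑ l, F i l (walkOp F k l j u)

/-- **Adjoint walk operators** (peeled from the right in the partner letters):
`adjWalkOp F' (k+1) i j = Σ_l adjWalkOp F' k l j ∘ F'_{il}`; these are the formal adjoints of the
walk operators up to sign (`inner_walkOp_left`). [folklore] -/
def adjWalkOp (F' : Fin m → Fin m → V → V) : ℕ → Fin m → Fin m → V → V
  | 0, i, j, u => F' i j u
  | k + 1, i, j, u => ∑ l, adjWalkOp F' k l j (F' i l u)

/-- **The closed-walk (Gelfand–Casimir) operator of degree `k + 1`**: `Σ_i walkOp F k i i`, the image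
of `Σ E_{i₀i₁} E_{i₁i₂} ⋯ E_{i_k i₀} ∈ 𝔷(𝔤𝔩_n)` when `F_{ij}` is the action of `E_{ij}`. [folklore] -/
def placeCasimirDeg (F : Fin m → Fin m → V → V) (k : ℕ) (u : V) : V := ∑ i, walkOp F k i i u

/-- The adjoint closed-walk operator `Σ_i adjWalkOp F' k i i`. [folklore] -/
def adjPlaceCasimirDeg (F' : Fin m → Fin m → V → V) (k : ℕ) (u : V) : V := ∑ i, adjWalkOp F' k i i u

omit [Module ℂ V] in
/-- Walks of length one are the letters. [folklore] -/
@[simp] theorem walkOp_zero (F : Fin m → Fin m → V → V) (i j : Fin m) (u : V) :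
    walkOp F 0 i j u = F i j u := rfl

omit [Module ℂ V] in
/-- Peeling the first letter of a walk. [folklore] -/
@[simp] theorem walkOp_succ (F : Fin m → Fin m → V → V) (k : ℕ) (i j : Fin m) (u : V) :
    walkOp F (k + 1) i j u = ∑ l, F i l (walkOp F k l j u) := rfl

omit [Module ℂ V] in
/-- Backward walks of length one are the partner letters. [folklore] -/
@[simp] theorem adjWalkOp_zero (F' : Fin m → Fin m → V → V) (i j : Fin m) (u : V) :
    adjWalkOp F' 0 i j u = F' i j u := rfl

omit [Module ℂ V] in
/-- Peeling the first letter of a backward walk. [folklore] -/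
@[simp] theorem adjWalkOp_succ (F' : Fin m → Fin m → V → V) (k : ℕ) (i j : Fin m) (u : V) :
    adjWalkOp F' (k + 1) i j u = ∑ l, adjWalkOp F' k l j (F' i l u) := rfl

variable (G : Submodule ℂ V) (F : Fin m → Fin m → V → V)
  (hFmem : ∀ i j, ∀ u ∈ G, F i j u ∈ G)
  (hFadd : ∀ i j, ∀ u ∈ G, ∀ u' ∈ G, F i j (u + u') = F i j u + F i j u')
  (hFsmul : ∀ i j (c : ℂ), ∀ u ∈ G, F i j (c • u) = c • F i j u)

include hFmem in
/-- Walk operators preserve the subspace. [folklore] -/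
theorem walkOp_mem : ∀ (k : ℕ) (i j : Fin m), ∀ u ∈ G, walkOp F k i j u ∈ G
  | 0, i, j, u, hu => hFmem i j u hu
  | k + 1, i, j, u, hu => by
    rw [walkOp_succ]
    exact Submodule.sum_mem _ fun l _ => hFmem i l _ (walkOp_mem k l j u hu)

include hFmem hFadd in
/-- Walk operators are additive on the subspace. [folklore] -/
theorem walkOp_add : ∀ (k : ℕ) (i j : Fin m), ∀ u ∈ G, ∀ u' ∈ G,
    walkOp F k i j (u + u') = walkOp F k i j u + walkOp F k i j u'
  | 0, i, j, u, hu, u', hu' => hFadd i j u hu u' hu'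
  | k + 1, i, j, u, hu, u', hu' => by
    simp only [walkOp_succ, ← Finset.sum_add_distrib]
    refine Finset.sum_congr rfl fun l _ => ?_
    rw [walkOp_add k l j u hu u' hu',
      hFadd i l _ (walkOp_mem G F hFmem k l j u hu) _ (walkOp_mem G F hFmem k l j u' hu')]

include hFmem hFsmul in
/-- Walk operators are homogeneous on the subspace. [folklore] -/
theorem walkOp_smul : ∀ (k : ℕ) (i j : Fin m) (c : ℂ), ∀ u ∈ G,
    walkOp F k i j (c • u) = c • walkOp F k i j u
  | 0, i, j, c, u, hu => hFsmul i j c u hu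
  | k + 1, i, j, c, u, hu => by
    simp only [walkOp_succ, Finset.smul_sum]
    refine Finset.sum_congr rfl fun l _ => ?_
    rw [walkOp_smul k l j c u hu, hFsmul i l c _ (walkOp_mem G F hFmem k l j u hu)]

include hFmem hFadd hFsmul in
/-- **Transformation law of the walk operators.** If `T F_{ij} u = Σ_{k,l} a_{ki} b_{jl} F_{kl} (T u)`
on `G` with `Σ_i a_{ki} b_{il} = δ_{kl}`, then for every length,
`T (walkOp F k i j u) = Σ_{k',l'} a_{k'i} b_{jl'} walkOp F k k' l' (T u)`: the intermediate
contractions `Σ_l b_{l l″} a_{k″ l} = δ_{k″ l″}` telescope. [cite: Knapp1986, Ch. VIII §3] -/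
theorem apply_walkOp_of_transform (T : V →ₗ[ℂ] V) (hT : ∀ u ∈ G, T u ∈ G)
    (a b : Fin m → Fin m → ℂ) (hab : ∀ k l, ∑ i, a k i * b i l = if k = l then 1 else 0)
    (htrans : ∀ i j, ∀ u ∈ G, T (F i j u) = ∑ k, ∑ l, (a k i * b j l) • F k l (T u)) :
    ∀ (k : ℕ) (i j : Fin m), ∀ u ∈ G,
      T (walkOp F k i j u) = ∑ k', ∑ l', (a k' i * b j l') • walkOp F k k' l' (T u)
  | 0, i, j, u, hu => by simpa using htrans i j u hu
  | k + 1, i, j, u, hu => by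
    have hTu : T u ∈ G := hT u hu
    have hF0 : ∀ i j, F i j 0 = 0 := fun i j => by
      have h := hFsmul i j 0 0 (Submodule.zero_mem _)
      rwa [zero_smul, zero_smul] at h
    have hFsum : ∀ p q (s : Finset (Fin m × Fin m)) (f : Fin m × Fin m → V), (∀ x ∈ s, f x ∈ G) →
        F p q (∑ x ∈ s, f x) = ∑ x ∈ s, F p q (f x) := fun p q s f hf =>
      map_finset_sum_of_forall_mem (F p q) (hFadd p q) (hF0 p q) s f hf
    rw [walkOp_succ, _root_.map_sum]
    -- expand each summand with the transformation laws
    have hexp : ∀ l, T (F i l (walkOp F k l j u)) =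
        ∑ k', ∑ l'', ∑ k'', ∑ l', ((a k' i * b l l'') * (a k'' l * b j l')) •
          F k' l'' (walkOp F k k'' l' (T u)) := by
      intro l
      rw [htrans i l _ (walkOp_mem G F hFmem k l j u hu),
        apply_walkOp_of_transform T hT a b hab htrans k l j u hu]
      refine Finset.sum_congr rfl fun k' _ => Finset.sum_congr rfl fun l'' _ => ?_
      rw [← Finset.sum_product', hFsum k' l'' _ _ fun x _ =>
        Submodule.smul_mem _ _ (walkOp_mem G F hFmem k _ _ _ hTu), Finset.smul_sum,
        ← Finset.sum_product']
      refine Finset.sum_congr rfl fun x _ => ?_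
      rw [hFsmul k' l'' _ _ (walkOp_mem G F hFmem k _ _ _ hTu), smul_smul]
    simp_rw [hexp]
    -- bring the sum over `l` (and `l''`, `k''`) inside and contract `Σ_l b_{l l''} a_{k'' l} = δ`
    rw [Finset.sum_comm]
    refine Finset.sum_congr rfl fun k' _ => ?_
    -- goal: Σ_l Σ_{l''} Σ_{k''} Σ_{l'} (…) • F k' l'' (W k'' l' (Tu)) = Σ_{l'} (a k' i * b j l') • W_{k+1} k' l' (Tu)
    calc ∑ l, ∑ l'', ∑ k'', ∑ l', ((a k' i * b l l'') * (a k'' l * b j l')) • F k' l'' (walkOp F k k'' l' (T u))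
        = ∑ l'', ∑ k'', ∑ l', (∑ l, (a k' i * b l l'') * (a k'' l * b j l')) • F k' l'' (walkOp F k k'' l' (T u)) := by
          rw [Finset.sum_comm]
          refine Finset.sum_congr rfl fun l'' _ => ?_
          rw [Finset.sum_comm]
          refine Finset.sum_congr rfl fun k'' _ => ?_
          rw [Finset.sum_comm]
          refine Finset.sum_congr rfl fun l' _ => ?_
          rw [Finset.sum_smul]
      _ = ∑ l'', ∑ k'', ∑ l', ((a k' i * b j l') * (if k'' = l'' then 1 else 0)) • F k' l'' (walkOp F k k'' l' (T u)) := by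
          refine Finset.sum_congr rfl fun l'' _ => Finset.sum_congr rfl fun k'' _ => Finset.sum_congr rfl fun l' _ => ?_
          congr 1
          rw [← hab k'' l'', Finset.mul_sum]
          refine Finset.sum_congr rfl fun l _ => ?_
          ring
      _ = ∑ l'', ∑ l', (a k' i * b j l') • F k' l'' (walkOp F k l'' l' (T u)) := by
          refine Finset.sum_congr rfl fun l'' _ => ?_
          rw [Finset.sum_comm]
          refine Finset.sum_congr rfl fun l' _ => ?_
          simp only [mul_ite, mul_one, mul_zero, ite_smul, zero_smul]
          rw [Finset.sum_ite_eq' Finset.univ l'' (fun k'' => (a k' i * b j l') • F k' l'' (walkOp F k k'' l' (T u))),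
            if_pos (Finset.mem_univ _)]
      _ = ∑ l', (a k' i * b j l') • walkOp F (k + 1) k' l' (T u) := by
          rw [Finset.sum_comm]
          refine Finset.sum_congr rfl fun l' _ => ?_
          rw [walkOp_succ, Finset.smul_sum]

include hFmem hFadd hFsmul in
/-- **The closed-walk operator commutes with `T`** under the hypotheses of
`apply_walkOp_of_transform`: `T (T_{k+1} v) = T_{k+1} (T v)` for `v ∈ G` (the last contraction
`Σ_i a_{k'i} b_{il'} = δ_{k'l'}` closes the walk). [cite: Knapp1986, Ch. VIII §3] -/
theorem apply_placeCasimirDeg_of_transform (T : V →ₗ[ℂ] V) (hT : ∀ u ∈ G, T u ∈ G)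
    (a b : Fin m → Fin m → ℂ) (hab : ∀ k l, ∑ i, a k i * b i l = if k = l then 1 else 0)
    (htrans : ∀ i j, ∀ u ∈ G, T (F i j u) = ∑ k, ∑ l, (a k i * b j l) • F k l (T u))
    (k : ℕ) {v : V} (hv : v ∈ G) :
    T (placeCasimirDeg F k v) = placeCasimirDeg F k (T v) := by
  unfold placeCasimirDeg
  rw [_root_.map_sum]
  simp_rw [apply_walkOp_of_transform G F hFmem hFadd hFsmul T hT a b hab htrans k _ _ v hv]
  rw [Finset.sum_comm]
  calc ∑ k', ∑ i, ∑ l', (a k' i * b i l') • walkOp F k k' l' (T v)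
      = ∑ k', ∑ l', (∑ i, a k' i * b i l') • walkOp F k k' l' (T v) := by
        refine Finset.sum_congr rfl fun k' _ => ?_
        rw [Finset.sum_comm]
        refine Finset.sum_congr rfl fun l' _ => ?_
        rw [Finset.sum_smul]
    _ = ∑ k', walkOp F k k' k' (T v) := by
        refine Finset.sum_congr rfl fun k' _ => ?_
        simp_rw [hab]
        simp only [ite_smul, one_smul, zero_smul, Finset.sum_ite_eq, Finset.mem_univ, if_true]

end Abstract

/-! ### 2. Formal adjoints of walk operators -/

section Adjoint

variable {V : Type*} [NormedAddCommGroup V] [InnerProductSpace ℂ V] {m : ℕ}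
  (G : Submodule ℂ V) (F F' : Fin m → Fin m → V → V)
  (hFmem : ∀ i j, ∀ u ∈ G, F i j u ∈ G) (hF'mem : ∀ i j, ∀ u ∈ G, F' i j u ∈ G)
  (hskew : ∀ i j, ∀ v ∈ G, ∀ u ∈ G, ⟪F i j v, u⟫_ℂ = -⟪v, F' i j u⟫_ℂ)

include hFmem hF'mem hskew in
/-- **Formal adjoint of a walk operator**: if `⟪F_{ij} v, u⟫ = -⟪v, F'_{ij} u⟫` on `G`, then
`⟪walkOp F k i j v, u⟫ = (-1)^{k+1} ⟪v, adjWalkOp F' k i j u⟫` for `v, u ∈ G`. [folklore] -/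
theorem inner_walkOp_left : ∀ (k : ℕ) (i j : Fin m), ∀ v ∈ G, ∀ u ∈ G,
    ⟪walkOp F k i j v, u⟫_ℂ = (-1 : ℂ) ^ (k + 1) * ⟪v, adjWalkOp F' k i j u⟫_ℂ
  | 0, i, j, v, hv, u, hu => by
    rw [walkOp_zero, adjWalkOp_zero, hskew i j v hv u hu]
    ring
  | k + 1, i, j, v, hv, u, hu => by
    rw [walkOp_succ, adjWalkOp_succ, sum_inner, inner_sum, Finset.mul_sum]
    refine Finset.sum_congr rfl fun l _ => ?_
    rw [hskew i l _ (walkOp_mem G F hFmem k l j v hv) u hu,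
      inner_walkOp_left k l j v hv _ (hF'mem i l u hu)]
    ring

include hFmem hF'mem hskew in
/-- **Formal adjoint of the closed-walk operator**: `⟪T_{k+1} v, u⟫ = ⟪v, (-1)^{k+1} T'_{k+1} u⟫`
for `v, u ∈ G`. [folklore] -/
theorem inner_placeCasimirDeg_left (k : ℕ) {v u : V} (hv : v ∈ G) (hu : u ∈ G) :
    ⟪placeCasimirDeg F k v, u⟫_ℂ = ⟪v, ((-1 : ℂ) ^ (k + 1)) • adjPlaceCasimirDeg F' k u⟫_ℂ := by
  unfold placeCasimirDeg adjPlaceCasimirDeg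
  rw [sum_inner, inner_smul_right, inner_sum, Finset.mul_sum]
  exact Finset.sum_congr rfl fun i _ => inner_walkOp_left G F F' hFmem hF'mem hskew k i i v hv u hu

end Adjoint

/-! ### 3. The Gelfand–Casimir operators of a place are scalars -/

section Places

variable {hcpt : isCompact_glFiniteIntegralLevel n K}
  {E : Type*} [NormedAddCommGroup E] [InnerProductSpace ℂ E] [CompleteSpace E]
  {τ : ContRepresentation ℂ (AutomorphyDatum.gl n K hcpt).arch.carrier E}

/-- **The Gelfand–Casimir operator of every degree of a real place is a scalar on the Gårding space**
of an irreducible unitary representation of `GL_n(K_∞)`: with `F_{ij} = τ(E_{ij} ⊗ r_w)`,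
`Σ_{i₀…i_k} F_{i₀i₁} ⋯ F_{i_k i₀} v = c • v` for all Gårding `v` (Segal's lemma for the `Ad(G)`-invariant
closed-walk operator, whose formal adjoint is `(-1)^{k+1}` times the backward closed-walk operator).
Jacquet–Shalika (1981), p. 523 ("`Z` operates by scalars"); Knapp (1986), Ch. VIII §3.
[cite: JacquetShalikaAJM1981, §3, Prop. (3.8), p. 523] [cite: Knapp1986, Ch. VIII §3] -/
theorem exists_placeCasimirRealDeg_eq_smul (hτ : τ.IsStronglyContinuous) (hτu : τ.IsUnitary)
    (hτi : τ.IsTopIrreducible) (w : {w : InfinitePlace K // IsReal w}) (k : ℕ) :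
    ∃ c : ℂ, ∀ v ∈ archGardingSpace hcpt τ,
      placeCasimirDeg (fun i j u => archDerivE hcpt τ (Matrix.single i j ((Pi.single w 1, 0) : mixedSpace K)) u)
        k v = c • v := by
  set r : mixedSpace K := (Pi.single w 1, 0) with hr
  set F : Fin n → Fin n → E → E := fun i j u => archDerivE hcpt τ (Matrix.single i j r) u with hF
  have hFmem : ∀ i j, ∀ u ∈ archGardingSpace hcpt τ, F i j u ∈ archGardingSpace hcpt τ :=
    fun i j u hu => archDerivE_mem_archGardingSpace hτ _ hu
  have hFadd : ∀ i j, ∀ u ∈ archGardingSpace hcpt τ, ∀ u' ∈ archGardingSpace hcpt τ,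
      F i j (u + u') = F i j u + F i j u' := fun i j u hu u' hu' => archDerivE_add_vec hτ _ hu hu'
  have hFsmul : ∀ i j (c : ℂ), ∀ u ∈ archGardingSpace hcpt τ, F i j (c • u) = c • F i j u :=
    fun i j c u hu => archDerivE_smul_vec hτ _ c hu
  refine exists_eq_smul_of_invariant_of_partner hτ hτu hτi (placeCasimirDeg F k)
    (fun u => ((-1 : ℂ) ^ (k + 1)) • adjPlaceCasimirDeg F k u)
    (fun v hv v' hv' => ?_) (fun c v hv => ?_) (fun g v hv => ?_) (fun v hv u hu => ?_)
  · unfold placeCasimirDeg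
    rw [← Finset.sum_add_distrib]
    exact Finset.sum_congr rfl fun i _ => walkOp_add _ F hFmem hFadd k i i v hv v' hv'
  · unfold placeCasimirDeg
    rw [Finset.smul_sum]
    exact Finset.sum_congr rfl fun i _ => walkOp_smul _ F hFmem hFsmul k i i c v hv
  · exact apply_placeCasimirDeg_of_transform (archGardingSpace hcpt τ) F hFmem hFadd hFsmul
      ((τ (toArch hcpt g) : E →L[ℂ] E) : E →ₗ[ℂ] E)
      (fun u hu => apply_mem_archGardingSpace hτ (toArch hcpt g) hu)
      (fun k i => (((g.val k i).1 w : ℝ) : ℂ)) (fun j l => ((((g⁻¹).val j l).1 w : ℝ) : ℂ))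
      (sum_fst_mul_fst_inv_eq w g)
      (fun i j u hu => by
        have h := apply_toArch_archDerivE_single_realIdem hτ w g i j hu
        simp only [Complex.ofReal_mul] at h
        exact h) k hv
  · exact inner_placeCasimirDeg_left (archGardingSpace hcpt τ) F F hFmem hFmem
      (fun i j v hv u hu => inner_archDerivE_left hτ hτu hv hu _) k hv hu

/-- **The holomorphic Gelfand–Casimir operator of every degree of a complex place is a scalar on the
Gårding space** of an irreducible unitary representation of `GL_n(K_∞)`:
`Σ_{i₀…i_k} τ^{hol}(E_{i₀i₁}) ⋯ τ^{hol}(E_{i_k i₀}) v = c • v` (Segal's lemma; the formal adjoint is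
`(-1)^{k+1}` times the backward antiholomorphic closed-walk operator).
[cite: JacquetShalikaAJM1981, §3, Prop. (3.8), p. 523] [cite: Knapp1986, Ch. VIII §3] -/
theorem exists_placeCasimirHolDeg_eq_smul (hτ : τ.IsStronglyContinuous) (hτu : τ.IsUnitary)
    (hτi : τ.IsTopIrreducible) (w : {w : InfinitePlace K // IsComplex w}) (k : ℕ) :
    ∃ c : ℂ, ∀ v ∈ archGardingSpace hcpt τ,
      placeCasimirDeg (fun i j u => archDerivHol hcpt τ w i j u) k v = c • v := by
  set F : Fin n → Fin n → E → E := fun i j u => archDerivHol hcpt τ w i j u with hF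
  set F' : Fin n → Fin n → E → E := fun i j u => archDerivAnti hcpt τ w i j u with hF'
  have hFmem : ∀ i j, ∀ u ∈ archGardingSpace hcpt τ, F i j u ∈ archGardingSpace hcpt τ :=
    fun i j u hu => archDerivHol_mem hτ w i j hu
  have hF'mem : ∀ i j, ∀ u ∈ archGardingSpace hcpt τ, F' i j u ∈ archGardingSpace hcpt τ :=
    fun i j u hu => archDerivAnti_mem hτ w i j hu
  have hFadd : ∀ i j, ∀ u ∈ archGardingSpace hcpt τ, ∀ u' ∈ archGardingSpace hcpt τ,
      F i j (u + u') = F i j u + F i j u' := fun i j u hu u' hu' => archDerivHol_add hτ w i j hu hu'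
  have hFsmul : ∀ i j (c : ℂ), ∀ u ∈ archGardingSpace hcpt τ, F i j (c • u) = c • F i j u :=
    fun i j c u hu => archDerivHol_smul hτ w i j c hu
  refine exists_eq_smul_of_invariant_of_partner hτ hτu hτi (placeCasimirDeg F k)
    (fun u => ((-1 : ℂ) ^ (k + 1)) • adjPlaceCasimirDeg F' k u)
    (fun v hv v' hv' => ?_) (fun c v hv => ?_) (fun g v hv => ?_) (fun v hv u hu => ?_)
  · unfold placeCasimirDeg
    rw [← Finset.sum_add_distrib]
    exact Finset.sum_congr rfl fun i _ => walkOp_add _ F hFmem hFadd k i i v hv v' hv'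
  · unfold placeCasimirDeg
    rw [Finset.smul_sum]
    exact Finset.sum_congr rfl fun i _ => walkOp_smul _ F hFmem hFsmul k i i c v hv
  · exact apply_placeCasimirDeg_of_transform (archGardingSpace hcpt τ) F hFmem hFadd hFsmul
      ((τ (toArch hcpt g) : E →L[ℂ] E) : E →ₗ[ℂ] E)
      (fun u hu => apply_mem_archGardingSpace hτ (toArch hcpt g) hu)
      (fun k i => (g.val k i).2 w) (fun j l => ((g⁻¹).val j l).2 w)
      (sum_snd_mul_snd_inv_eq w g)
      (fun i j u hu => apply_toArch_archDerivHol hτ w g i j hu) k hv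
  · exact inner_placeCasimirDeg_left (archGardingSpace hcpt τ) F F' hFmem hF'mem
      (fun i j v hv u hu => inner_archDerivHol_left hτ hτu w i j hv hu) k hv hu

/-- **The antiholomorphic Gelfand–Casimir operator of every degree of a complex place is a scalar on
the Gårding space** of an irreducible unitary representation of `GL_n(K_∞)`.
[cite: JacquetShalikaAJM1981, §3, Prop. (3.8), p. 523] [cite: Knapp1986, Ch. VIII §3] -/
theorem exists_placeCasimirAntiDeg_eq_smul (hτ : τ.IsStronglyContinuous) (hτu : τ.IsUnitary)
    (hτi : τ.IsTopIrreducible) (w : {w : InfinitePlace K // IsComplex w}) (k : ℕ) :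
    ∃ c : ℂ, ∀ v ∈ archGardingSpace hcpt τ,
      placeCasimirDeg (fun i j u => archDerivAnti hcpt τ w i j u) k v = c • v := by
  set F : Fin n → Fin n → E → E := fun i j u => archDerivAnti hcpt τ w i j u with hF
  set F' : Fin n → Fin n → E → E := fun i j u => archDerivHol hcpt τ w i j u with hF'
  have hFmem : ∀ i j, ∀ u ∈ archGardingSpace hcpt τ, F i j u ∈ archGardingSpace hcpt τ :=
    fun i j u hu => archDerivAnti_mem hτ w i j hu
  have hF'mem : ∀ i j, ∀ u ∈ archGardingSpace hcpt τ, F' i j u ∈ archGardingSpace hcpt τ :=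
    fun i j u hu => archDerivHol_mem hτ w i j hu
  have hFadd : ∀ i j, ∀ u ∈ archGardingSpace hcpt τ, ∀ u' ∈ archGardingSpace hcpt τ,
      F i j (u + u') = F i j u + F i j u' := fun i j u hu u' hu' => archDerivAnti_add hτ w i j hu hu'
  have hFsmul : ∀ i j (c : ℂ), ∀ u ∈ archGardingSpace hcpt τ, F i j (c • u) = c • F i j u :=
    fun i j c u hu => archDerivAnti_smul hτ w i j c hu
  refine exists_eq_smul_of_invariant_of_partner hτ hτu hτi (placeCasimirDeg F k)
    (fun u => ((-1 : ℂ) ^ (k + 1)) • adjPlaceCasimirDeg F' k u)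
    (fun v hv v' hv' => ?_) (fun c v hv => ?_) (fun g v hv => ?_) (fun v hv u hu => ?_)
  · unfold placeCasimirDeg
    rw [← Finset.sum_add_distrib]
    exact Finset.sum_congr rfl fun i _ => walkOp_add _ F hFmem hFadd k i i v hv v' hv'
  · unfold placeCasimirDeg
    rw [Finset.smul_sum]
    exact Finset.sum_congr rfl fun i _ => walkOp_smul _ F hFmem hFsmul k i i c v hv
  · exact apply_placeCasimirDeg_of_transform (archGardingSpace hcpt τ) F hFmem hFadd hFsmul
      ((τ (toArch hcpt g) : E →L[ℂ] E) : E →ₗ[ℂ] E)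
      (fun u hu => apply_mem_archGardingSpace hτ (toArch hcpt g) hu)
      (fun k i => conj ((g.val k i).2 w)) (fun j l => conj (((g⁻¹).val j l).2 w))
      (sum_conj_snd_mul_conj_snd_inv_eq w g)
      (fun i j u hu => apply_toArch_archDerivAnti hτ w g i j hu) k hv
  · exact inner_placeCasimirDeg_left (archGardingSpace hcpt τ) F F' hFmem hF'mem
      (fun i j v hv u hu => inner_archDerivAnti_left hτ hτu w i j hv hu) k hv hu

/-- Consistency with degree `2`: the closed-walk operator of degree `2` is the place Casimir operator
`Σ_{ij} F_{ij} F_{ji}` of `ArchPlaceCasimirScalar`. [folklore] -/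
theorem placeCasimirDeg_one {V : Type*} [AddCommGroup V] {m : ℕ} (F : Fin m → Fin m → V → V) (u : V) :
    placeCasimirDeg F 1 u = ∑ i, ∑ j, F i j (F j i u) := rfl

/-- The closed-walk operator of degree `3` written out: `Σ_{i,j,l} F_{ij} F_{jl} F_{li}` — the cubic
Gelfand–Casimir operator `T₃` of `Literature.Algebra.Lie.GL3Whittaker` (hypothesis "`T₃` acts by a
scalar" there). [folklore] -/
theorem placeCasimirDeg_two {V : Type*} [AddCommGroup V] {m : ℕ} (F : Fin m → Fin m → V → V) (u : V) :
    placeCasimirDeg F 2 u = ∑ i, ∑ j, F i j (∑ l, F j l (F l i u)) := rfl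

end Places

end Literature.NumberTheory.Automorphic
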